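import Summits.Ventures.YMGap.RobustBall.TorusRowsSU3Variance
import Summits.Ventures.YMGap.RobustBall.TorusClusteringYM3
import HarnessLib

/-!
# Venture YMGap, Y2 → Y4 seam for `SU(3)`: the `β⋆`-UNIFORM torus clustering currency and Y4's receiving conjecture
# `YM3IR.ClusterDomainClustering` for the `SU(3)` balls, `d = 3`, on the cell's certified pair (variance door)

HONEST FRAMING.  Venture file of the cell `pub-ymgap` (QuantumFields programme), seat engine-2 (g6).  Strong-coupling LATTICE statements
only: `SU(3)` lattice Yang–Mills on the tori `(ℤ/L)^d`, `L ≥ 3`, Wilson's action at tree coupling `β' ≤ β⋆ = β⋆_W/3` plus a member of the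
tier-1 ball `ClusterDomainFR (2ε) ε r` (resp. tier-2 ball `ClusterDomain κ (2ε) ε`); conclusions = `RobustBall.TorusClusteringOnBallUpTo`
(ONE constant `24` and ONE rate for every `0 ≤ β' ≤ β⋆`) and, at `d = 3`, Y4's `YM3IR.ClusterDomainClustering` for the ball spec
(fundamental `SU(3)`, ceiling `β⋆`, membership in the ball) — the hypothesis `hRB` of the YM₃ infrared statement, inhabited for `SU(3)`
CONDITIONALLY on the cell's certified pair.  Nothing about the continuum limit, the YM₃ mass gap itself, or Clay.  Kernel arithmetic over
ds-2's variance torus door (`robustTorusDoor(W)_of_poincare_of_varianceBound`, `RobustTorusDoor.mono`, `clusteringFromDoorTarget_holds`,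
`torusClusteringOnBallW_of_poincare_of_varianceBound`) and ds-2's Y2 → Y4 bridge (`clusterDomainClustering_of_torusClusteringOnBallUpTo /
_of_torusClusteringOnBallW`), fed with P11: H1 `OneLinkPoincareSUN 3 (3/5) (4/5)` (→ radius `11/30`), H2 `OneLinkVarianceBound 3 (11/30) (49/20)`,
`√(cv) = 7/5`.  NOTHING asserted about H1/H2: class «K × C(H1) × C-iv(H2)», never K.

ROWS (`d = 3`, the Y4 dimension; row value `ρ_V(β⋆_W, ε) = e^{2ε}(28/15)β⋆_W + e^{ε}√(4/5)ε`, door threshold `15/28`, radius cap `33/40`):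
tier 1 `YM3IR.ClusterDomainClustering ⟨fundamentalRep (Fin 3), β⋆_W/3, ClusterDomainFR (2ε) ε r⟩ suFrobDist (−log ρ_V/(r ⊔ 1))` at
`(β⋆_W, ε) = (1/4, .230) (3/10, .181) (2/5, .096) (9/20, .058)`; tier 2 (`κ = log 6/5`, rate `log 6/5`) at `(1/4, .181) (1/3, .096)`.
Also the `d = 4` UpTo rows `(1/8, .299) (1/4, .116)` (no Y4 use; for rb-theory's `TorusClusteringOnBallUpTo` column).
-/

noncomputable section

open MeasureTheory ProbabilityTheory Real
open Literature.MathematicalPhysics.QuantumLattice (fundamentalRep)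
open Literature.MathematicalPhysics.QuantumFieldTheory
open Literature.MathematicalPhysics.QuantumFieldTheory.SUNBakryEmery (SUN)
open Summit.QuantumFields.BalabanUV.InfraRed.StrongCouplingPoincareDoorSUN (OneLinkPoincareSUN OneLinkPoincareSUN.mono)
open Summit.QuantumFields.BalabanUV.InfraRed.StrongCouplingVarianceDoorSUN (OneLinkVarianceBound)
open Summit.Ventures.YMGap.RobustBall (TorusClusteringOnBall TorusClusteringOnBallW TorusClusteringOnBallUpTo ClusterDomainFR ClusterDomain
  robustTorusDoor_of_poincare_of_varianceBound RobustTorusDoor.mono clusteringFromDoorTarget_holds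
  torusClusteringOnBallW_of_poincare_of_varianceBound clusterDomainClustering_of_torusClusteringOnBallUpTo
  clusterDomainClustering_of_torusClusteringOnBallW)

namespace Summit.Ventures.YMGap.RobustBallSU3

variable {d : ℕ}

/-! ### 1. The `β⋆`-uniform currency on P11, every `d ≥ 2`, tiers 1 and 2 -/

/-- **`SU(3)`, every `d ≥ 2`: torus clustering UNIFORMLY UP TO `β⋆` on the tier-1 ball, variance door on P11** (CONDITIONAL on H1, H2):
for `0 < β⋆_W` with `(d−1)β⋆_W ≤ 33/20`, `0 ≤ ε` and `ρ⋆ = e^{2ε}(14/15)(d−1)β⋆_W + e^{ε}√(4/5)ε < 1`, EVERY tree coupling `0 ≤ β' ≤ β⋆_W/3` and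
every member of `ClusterDomainFR (2ε) ε r` on every torus `L ≥ 3` cluster with the SAME constant `24` and rate `−log ρ⋆/(r ⊔ 1)` (the door's row
value is increasing in the coupling). [folklore] -/
theorem su3_torusClusteringOnBallUpTo_variance (hd : 2 ≤ d) (hP : OneLinkPoincareSUN 3 (3 / 5) (4 / 5))
    (hV : OneLinkVarianceBound 3 (11 / 30) (49 / 20)) {βW ε : ℝ} (hβ0 : 0 < βW) (hR : ((d : ℝ) - 1) * βW ≤ 33 / 20)
    (hε : 0 ≤ ε) (r : ℕ) (hρ1 : exp (2 * ε) * (14 / 15 * (((d : ℝ) - 1) * βW)) + exp ε * Real.sqrt (4 / 5) * ε < 1) :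
    TorusClusteringOnBallUpTo 3 d (βW / 3) (2 * ε) ε r 24
      (-Real.log (exp (2 * ε) * (14 / 15 * (((d : ℝ) - 1) * βW)) + exp ε * Real.sqrt (4 / 5) * ε) / max r 1) := by
  intro β hb0 hbs
  have hd1 : (0 : ℝ) ≤ (d : ℝ) - 1 := by
    have : (2 : ℝ) ≤ d := by exact_mod_cast hd
    linarith
  have hβabs : |β| = β := abs_of_nonneg hb0
  have hsq : Real.sqrt (4 / 5 * (49 / 20)) = 7 / 5 := by
    rw [show (4 / 5 * (49 / 20) : ℝ) = (7 / 5) ^ 2 by norm_num, Real.sqrt_sq (by norm_num)]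
  have hb : |β| / ((3 : ℕ) : ℝ) * (2 * ((d : ℝ) - 1)) ≤ 11 / 30 := by
    rw [hβabs, Nat.cast_ofNat]; nlinarith
  have hdoor := robustTorusDoor_of_poincare_of_varianceBound (d := d) (N := 3) (by omega) (by norm_num) (β := β)
    (ε₀ := 2 * ε) (ε₁ := ε) (by norm_num) (by norm_num) hb (hP.mono (by norm_num) le_rfl) hV r
  have hle : exp (2 * ε) * Real.sqrt (4 / 5 * (49 / 20)) * (|β| / ((3 : ℕ) : ℝ)) * (6 * ((d : ℝ) - 1)) +
        exp (2 * ε / 2) * Real.sqrt (4 / 5) * ε ≤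
      exp (2 * ε) * (14 / 15 * (((d : ℝ) - 1) * βW)) + exp ε * Real.sqrt (4 / 5) * ε := by
    rw [hsq, hβabs, Nat.cast_ofNat, show 2 * ε / 2 = ε by ring]
    have : exp (2 * ε) * (7 / 5) * (β / 3) * (6 * ((d : ℝ) - 1)) ≤ exp (2 * ε) * (14 / 15 * (((d : ℝ) - 1) * βW)) := by
      have h1 : β * ((d : ℝ) - 1) ≤ βW / 3 * ((d : ℝ) - 1) := mul_le_mul_of_nonneg_right hbs hd1
      nlinarith [exp_pos (2 * ε)]
    linarith
  have h := clusteringFromDoorTarget_holds 3 d β (2 * ε) ε _ r (hdoor.mono hle) (torus_rowValue_pos hd hβ0 hε) hρ1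
  have h24 : (8 : ℝ) * ((3 : ℕ) : ℝ) = 24 := by norm_num
  rw [h24] at h
  exact h

/-- **`SU(3)`, every `d ≥ 2`: tier-2 torus clustering UNIFORMLY UP TO `β⋆`** (weight `e^{κ·diam}`, `κ ≥ 0`; CONDITIONAL on H1, H2): if
`e^{κ}e^{2ε}(14/15)(d−1)β⋆_W + e^{ε}√(4/5)ε < 1` then for every `0 ≤ β' ≤ β⋆_W/3`, `TorusClusteringOnBallW 3 d β' κ (2ε) ε 24 κ`. [folklore] -/
theorem su3_torusClusteringOnBallW_upTo_variance (hd : 2 ≤ d) (hP : OneLinkPoincareSUN 3 (3 / 5) (4 / 5))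
    (hV : OneLinkVarianceBound 3 (11 / 30) (49 / 20)) {κ βW ε : ℝ} (hκ : 0 ≤ κ) (hβ0 : 0 < βW)
    (hR : ((d : ℝ) - 1) * βW ≤ 33 / 20) (hε : 0 ≤ ε)
    (hρ1 : exp κ * (exp (2 * ε) * (14 / 15 * (((d : ℝ) - 1) * βW))) + exp ε * Real.sqrt (4 / 5) * ε < 1) :
    ∀ β : ℝ, 0 ≤ β → β ≤ βW / 3 → TorusClusteringOnBallW 3 d β κ (2 * ε) ε 24 κ := by
  intro β hb0 hbs
  have hd1 : (0 : ℝ) ≤ (d : ℝ) - 1 := by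
    have : (2 : ℝ) ≤ d := by exact_mod_cast hd
    linarith
  have hβabs : |β| = β := abs_of_nonneg hb0
  have hsq : Real.sqrt (4 / 5 * (49 / 20)) = 7 / 5 := by
    rw [show (4 / 5 * (49 / 20) : ℝ) = (7 / 5) ^ 2 by norm_num, Real.sqrt_sq (by norm_num)]
  have hb : |β| / ((3 : ℕ) : ℝ) * (2 * ((d : ℝ) - 1)) ≤ 11 / 30 := by
    rw [hβabs, Nat.cast_ofNat]; nlinarith
  have hle : exp κ * exp (2 * ε) * Real.sqrt (4 / 5 * (49 / 20)) * (|β| / ((3 : ℕ) : ℝ)) * (6 * ((d : ℝ) - 1)) +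
        exp (2 * ε / 2) * Real.sqrt (4 / 5) * ε ≤
      exp κ * (exp (2 * ε) * (14 / 15 * (((d : ℝ) - 1) * βW))) + exp ε * Real.sqrt (4 / 5) * ε := by
    rw [hsq, hβabs, Nat.cast_ofNat, show 2 * ε / 2 = ε by ring]
    have h1 : β * ((d : ℝ) - 1) ≤ βW / 3 * ((d : ℝ) - 1) := mul_le_mul_of_nonneg_right hbs hd1
    have h2 : exp κ * exp (2 * ε) * (7 / 5) * (β / 3) * (6 * ((d : ℝ) - 1)) ≤
        exp κ * (exp (2 * ε) * (14 / 15 * (((d : ℝ) - 1) * βW))) := by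
      nlinarith [mul_pos (exp_pos κ) (exp_pos (2 * ε))]
    linarith
  have h := torusClusteringOnBallW_of_poincare_of_varianceBound (d := d) (N := 3) (by omega) (by norm_num) (β := β) (κ := κ)
    (ε₀ := 2 * ε) (ε₁ := ε) hκ (by norm_num) (by norm_num) hb (hP.mono (by norm_num) le_rfl) hV hε (lt_of_le_of_lt hle hρ1)
  have h24 : (8 : ℝ) * ((3 : ℕ) : ℝ) = 24 := by norm_num
  rw [h24] at h
  exact h

/-! ### 2. Y4's receiving conjecture for the `SU(3)` balls (`d = 3`), tiers 1 and 2 -/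

/-- **Y4's `ClusterDomainClustering` for the `SU(3)` tier-1 ball, variance door on P11** (CONDITIONAL on H1, H2): for `0 < β⋆_W ≤ 33/40`,
`0 ≤ ε` and `ρ⋆ = e^{2ε}(28/15)β⋆_W + e^{ε}√(4/5)ε < 1`, the ball spec (fundamental `SU(3)`, ceiling `β⋆_W/3`, membership in
`ClusterDomainFR (2ε) ε r`) clusters at rate `−log ρ⋆/(r ⊔ 1)`. [folklore] -/
theorem su3_clusterDomainClustering_variance (hP : OneLinkPoincareSUN 3 (3 / 5) (4 / 5))
    (hV : OneLinkVarianceBound 3 (11 / 30) (49 / 20)) {βW ε : ℝ} (hβ0 : 0 < βW) (hR : βW ≤ 33 / 40) (hε : 0 ≤ ε) (r : ℕ)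
    (hρ1 : exp (2 * ε) * (28 / 15 * βW) + exp ε * Real.sqrt (4 / 5) * ε < 1) :
    YM3IR.ClusterDomainClustering (G := SUN 3)
      ⟨fundamentalRep (Fin 3), βW / 3, fun _ _ W => W ∈ ClusterDomainFR (2 * ε) ε r⟩ suFrobDist
      (-Real.log (exp (2 * ε) * (28 / 15 * βW) + exp ε * Real.sqrt (4 / 5) * ε) / max r 1) := by
  have e : (14 : ℝ) / 15 * ((((3 : ℕ) : ℝ) - 1) * βW) = 28 / 15 * βW := by push_cast; ring
  have h := su3_torusClusteringOnBallUpTo_variance (d := 3) (by norm_num) hP hV hβ0 (by push_cast; linarith) hε r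
    (by rw [e]; exact hρ1)
  rw [e] at h
  exact clusterDomainClustering_of_torusClusteringOnBallUpTo h

/-- **Y4's `ClusterDomainClustering` for the `SU(3)` TIER-2 ball `ClusterDomain κ (2ε) ε`** (the diameter-weighted ball Y4 hands over; CONDITIONAL
on H1, H2): for `κ ≥ 0`, `0 < β⋆_W ≤ 33/40`, `0 ≤ ε`, `e^{κ}e^{2ε}(28/15)β⋆_W + e^{ε}√(4/5)ε < 1`: rate `κ`. [folklore] -/
theorem su3_clusterDomainClusteringW_variance (hP : OneLinkPoincareSUN 3 (3 / 5) (4 / 5))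
    (hV : OneLinkVarianceBound 3 (11 / 30) (49 / 20)) {κ βW ε : ℝ} (hκ : 0 ≤ κ) (hβ0 : 0 < βW) (hR : βW ≤ 33 / 40) (hε : 0 ≤ ε)
    (hρ1 : exp κ * (exp (2 * ε) * (28 / 15 * βW)) + exp ε * Real.sqrt (4 / 5) * ε < 1) :
    YM3IR.ClusterDomainClustering (G := SUN 3)
      ⟨fundamentalRep (Fin 3), βW / 3, fun _ _ W => W ∈ ClusterDomain κ (2 * ε) ε⟩ suFrobDist κ := by
  have e : (14 : ℝ) / 15 * ((((3 : ℕ) : ℝ) - 1) * βW) = 28 / 15 * βW := by push_cast; ring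
  exact clusterDomainClustering_of_torusClusteringOnBallW (A := 24)
    (su3_torusClusteringOnBallW_upTo_variance (d := 3) (by norm_num) hP hV hκ hβ0 (by push_cast; linarith) hε (by rw [e]; exact hρ1))

/-! ### 3. Row schemas with rational certificates and the rows of record -/

/-- **UpTo row schema, every `d ≥ 2`** (rational certificate `T(2ε)(14/15)(d−1)β⋆_W + T(ε)·0.8945·ε < 1`). [folklore] -/
theorem su3_torusRowUpTo (hd : 2 ≤ d) (hP : OneLinkPoincareSUN 3 (3 / 5) (4 / 5)) (hV : OneLinkVarianceBound 3 (11 / 30) (49 / 20))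
    {βW ε : ℝ} (hβ0 : 0 < βW) (hR : ((d : ℝ) - 1) * βW ≤ 33 / 20) (hε0 : 0 ≤ ε) (hε1 : ε ≤ 1 / 2) (r : ℕ)
    (hcert : (1 + 2 * ε + (2 * ε) ^ 2 / 2 + (2 * ε) ^ 3 / 6 + 5 / 96 * (2 * ε) ^ 4) * (14 / 15 * (((d : ℝ) - 1) * βW)) +
        (1 + ε + ε ^ 2 / 2 + ε ^ 3 / 6 + 5 / 96 * ε ^ 4) * 0.8945 * ε < 1) :
    TorusClusteringOnBallUpTo 3 d (βW / 3) (2 * ε) ε r 24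
      (-Real.log (exp (2 * ε) * (14 / 15 * (((d : ℝ) - 1) * βW)) + exp ε * Real.sqrt (4 / 5) * ε) / max r 1) :=
  su3_torusClusteringOnBallUpTo_variance hd hP hV hβ0 hR hε0 r (lt_of_le_of_lt (torus_rowValue_le_taylor hd hβ0 hε0 hε1) hcert)

/-- **Y4 row schema (`d = 3`, tier 1)**: `0 < β⋆_W ≤ 33/40`, `0 ≤ ε ≤ 1/2`, certificate `T(2ε)(28/15)β⋆_W + T(ε)·0.8945·ε < 1` ⇒
`YM3IR.ClusterDomainClustering` for the `SU(3)` tier-1 ball spec at ceiling `β⋆_W/3`, rate `−log ρ⋆/(r ⊔ 1)`. [folklore] -/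
theorem su3_ym3Row (hP : OneLinkPoincareSUN 3 (3 / 5) (4 / 5)) (hV : OneLinkVarianceBound 3 (11 / 30) (49 / 20)) {βW ε : ℝ}
    (hβ0 : 0 < βW) (hR : βW ≤ 33 / 40) (hε0 : 0 ≤ ε) (hε1 : ε ≤ 1 / 2) (r : ℕ)
    (hcert : (1 + 2 * ε + (2 * ε) ^ 2 / 2 + (2 * ε) ^ 3 / 6 + 5 / 96 * (2 * ε) ^ 4) * (28 / 15 * βW) +
        (1 + ε + ε ^ 2 / 2 + ε ^ 3 / 6 + 5 / 96 * ε ^ 4) * 0.8945 * ε < 1) :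
    YM3IR.ClusterDomainClustering (G := SUN 3)
      ⟨fundamentalRep (Fin 3), βW / 3, fun _ _ W => W ∈ ClusterDomainFR (2 * ε) ε r⟩ suFrobDist
      (-Real.log (exp (2 * ε) * (28 / 15 * βW) + exp ε * Real.sqrt (4 / 5) * ε) / max r 1) := by
  have e : (14 : ℝ) / 15 * ((((3 : ℕ) : ℝ) - 1) * βW) = 28 / 15 * βW := by push_cast; ring
  have ht := torus_rowValue_le_taylor (d := 3) (by norm_num) hβ0 hε0 hε1 (ε := ε)
  rw [e] at ht
  exact su3_clusterDomainClustering_variance hP hV hβ0 hR hε0 r (lt_of_le_of_lt ht (by simpa using hcert))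

/-- **Y4 row schema (`d = 3`, tier 2, `e^κ ≤ k`)**: certificate `k·T(2ε)(28/15)β⋆_W + T(ε)·0.8945·ε < 1` ⇒ `ClusterDomainClustering` for the
`SU(3)` tier-2 ball spec `ClusterDomain κ (2ε) ε` at ceiling `β⋆_W/3`, rate `κ`. [folklore] -/
theorem su3_ym3RowW (hP : OneLinkPoincareSUN 3 (3 / 5) (4 / 5)) (hV : OneLinkVarianceBound 3 (11 / 30) (49 / 20)) {κ k βW ε : ℝ}
    (hκ : 0 ≤ κ) (hk : exp κ ≤ k) (hβ0 : 0 < βW) (hR : βW ≤ 33 / 40) (hε0 : 0 ≤ ε) (hε1 : ε ≤ 1 / 2)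
    (hcert : k * ((1 + 2 * ε + (2 * ε) ^ 2 / 2 + (2 * ε) ^ 3 / 6 + 5 / 96 * (2 * ε) ^ 4) * (28 / 15 * βW)) +
        (1 + ε + ε ^ 2 / 2 + ε ^ 3 / 6 + 5 / 96 * ε ^ 4) * 0.8945 * ε < 1) :
    YM3IR.ClusterDomainClustering (G := SUN 3)
      ⟨fundamentalRep (Fin 3), βW / 3, fun _ _ W => W ∈ ClusterDomain κ (2 * ε) ε⟩ suFrobDist κ := by
  refine su3_clusterDomainClusteringW_variance hP hV hκ hβ0 hR hε0 (lt_of_le_of_lt ?_ hcert)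
  have hA : exp (2 * ε) * (28 / 15 * βW) ≤ (1 + 2 * ε + (2 * ε) ^ 2 / 2 + (2 * ε) ^ 3 / 6 + 5 / 96 * (2 * ε) ^ 4) * (28 / 15 * βW) :=
    mul_le_mul_of_nonneg_right (exp_le_taylor4 (by linarith) (by linarith)) (by positivity)
  have hB : exp ε * Real.sqrt (4 / 5) * ε ≤ (1 + ε + ε ^ 2 / 2 + ε ^ 3 / 6 + 5 / 96 * ε ^ 4) * 0.8945 * ε :=
    mul_le_mul_of_nonneg_right (mul_le_mul (exp_le_taylor4 hε0 (by linarith)) sqrt_four_fifths_le (Real.sqrt_nonneg _)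
      (by positivity)) hε0
  have hkA := mul_le_mul hk hA (by positivity) ((exp_pos κ).le.trans hk)
  linarith

/-- **Y4 ROW, `SU(3)` tier 1, `(β⋆_W, ε) = (1/4, 0.230)`**: `ClusterDomainClustering` for the `SU(3)` ball spec at ceiling `1/12` (tree coupling),
membership `ClusterDomainFR 0.46 0.23 r`, every range `r`; on H1, H2. [folklore] -/
theorem su3_ym3Row_1_4 (hP : OneLinkPoincareSUN 3 (3 / 5) (4 / 5)) (hV : OneLinkVarianceBound 3 (11 / 30) (49 / 20)) (r : ℕ) :
    YM3IR.ClusterDomainClustering (G := SUN 3)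
      ⟨fundamentalRep (Fin 3), (1 / 4 : ℝ) / 3, fun _ _ W => W ∈ ClusterDomainFR (2 * (23 / 100 : ℝ)) (23 / 100) r⟩ suFrobDist
      (-Real.log (exp (2 * (23 / 100)) * (28 / 15 * (1 / 4)) + exp (23 / 100) * Real.sqrt (4 / 5) * (23 / 100)) / max r 1) :=
  su3_ym3Row hP hV (by norm_num) (by norm_num) (by norm_num) (by norm_num) r (by norm_num)

/-- **Y4 ROW, `SU(3)` tier 1, `(3/10, 0.181)`** on H1, H2. [folklore] -/
theorem su3_ym3Row_3_10 (hP : OneLinkPoincareSUN 3 (3 / 5) (4 / 5)) (hV : OneLinkVarianceBound 3 (11 / 30) (49 / 20)) (r : ℕ) :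
    YM3IR.ClusterDomainClustering (G := SUN 3)
      ⟨fundamentalRep (Fin 3), (3 / 10 : ℝ) / 3, fun _ _ W => W ∈ ClusterDomainFR (2 * (181 / 1000 : ℝ)) (181 / 1000) r⟩ suFrobDist
      (-Real.log (exp (2 * (181 / 1000)) * (28 / 15 * (3 / 10)) + exp (181 / 1000) * Real.sqrt (4 / 5) * (181 / 1000)) / max r 1) :=
  su3_ym3Row hP hV (by norm_num) (by norm_num) (by norm_num) (by norm_num) r (by norm_num)

/-- **Y4 ROW, `SU(3)` tier 1, `(2/5, 0.096)`** on H1, H2. [folklore] -/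
theorem su3_ym3Row_2_5 (hP : OneLinkPoincareSUN 3 (3 / 5) (4 / 5)) (hV : OneLinkVarianceBound 3 (11 / 30) (49 / 20)) (r : ℕ) :
    YM3IR.ClusterDomainClustering (G := SUN 3)
      ⟨fundamentalRep (Fin 3), (2 / 5 : ℝ) / 3, fun _ _ W => W ∈ ClusterDomainFR (2 * (12 / 125 : ℝ)) (12 / 125) r⟩ suFrobDist
      (-Real.log (exp (2 * (12 / 125)) * (28 / 15 * (2 / 5)) + exp (12 / 125) * Real.sqrt (4 / 5) * (12 / 125)) / max r 1) :=
  su3_ym3Row hP hV (by norm_num) (by norm_num) (by norm_num) (by norm_num) r (by norm_num)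

/-- **Y4 ROW, `SU(3)` tier 1, `(9/20, 0.058)`** on H1, H2. [folklore] -/
theorem su3_ym3Row_9_20 (hP : OneLinkPoincareSUN 3 (3 / 5) (4 / 5)) (hV : OneLinkVarianceBound 3 (11 / 30) (49 / 20)) (r : ℕ) :
    YM3IR.ClusterDomainClustering (G := SUN 3)
      ⟨fundamentalRep (Fin 3), (9 / 20 : ℝ) / 3, fun _ _ W => W ∈ ClusterDomainFR (2 * (29 / 500 : ℝ)) (29 / 500) r⟩ suFrobDist
      (-Real.log (exp (2 * (29 / 500)) * (28 / 15 * (9 / 20)) + exp (29 / 500) * Real.sqrt (4 / 5) * (29 / 500)) / max r 1) :=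
  su3_ym3Row hP hV (by norm_num) (by norm_num) (by norm_num) (by norm_num) r (by norm_num)

/-- **Y4 ROW, `SU(3)` tier 2 (`κ = log 6/5`), `(1/4, 0.181)`**: `ClusterDomainClustering` for the `SU(3)` tier-2 ball spec `ClusterDomain (log 6/5) 0.362 0.181`
at ceiling `1/12`, rate `log(6/5)`; on H1, H2. [folklore] -/
theorem su3_ym3RowW_1_4 (hP : OneLinkPoincareSUN 3 (3 / 5) (4 / 5)) (hV : OneLinkVarianceBound 3 (11 / 30) (49 / 20)) :
    YM3IR.ClusterDomainClustering (G := SUN 3)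
      ⟨fundamentalRep (Fin 3), (1 / 4 : ℝ) / 3, fun _ _ W => W ∈ ClusterDomain (Real.log (6 / 5)) (2 * (181 / 1000 : ℝ)) (181 / 1000)⟩
      suFrobDist (Real.log (6 / 5)) :=
  su3_ym3RowW hP hV (k := 6 / 5) (Real.log_nonneg (by norm_num)) (by rw [Real.exp_log (by norm_num)]) (by norm_num) (by norm_num)
    (by norm_num) (by norm_num) (by norm_num)

/-- **Y4 ROW, `SU(3)` tier 2 (`κ = log 6/5`), `(1/3, 0.096)`** on H1, H2. [folklore] -/
theorem su3_ym3RowW_1_3 (hP : OneLinkPoincareSUN 3 (3 / 5) (4 / 5)) (hV : OneLinkVarianceBound 3 (11 / 30) (49 / 20)) :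
    YM3IR.ClusterDomainClustering (G := SUN 3)
      ⟨fundamentalRep (Fin 3), (1 / 3 : ℝ) / 3, fun _ _ W => W ∈ ClusterDomain (Real.log (6 / 5)) (2 * (12 / 125 : ℝ)) (12 / 125)⟩
      suFrobDist (Real.log (6 / 5)) :=
  su3_ym3RowW hP hV (k := 6 / 5) (Real.log_nonneg (by norm_num)) (by rw [Real.exp_log (by norm_num)]) (by norm_num) (by norm_num)
    (by norm_num) (by norm_num) (by norm_num)

/-- `d = 4` UpTo row `(β⋆_W, ε) = (1/8, 0.299)`: `TorusClusteringOnBallUpTo 3 4 ((1/8)/3) 0.598 0.299 r 24 (rate)` on H1, H2. [folklore] -/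
theorem su3_torusRowUpTo4_1_8 (hP : OneLinkPoincareSUN 3 (3 / 5) (4 / 5)) (hV : OneLinkVarianceBound 3 (11 / 30) (49 / 20)) (r : ℕ) :
    TorusClusteringOnBallUpTo 3 4 ((1 / 8 : ℝ) / 3) (2 * (299 / 1000)) (299 / 1000) r 24
      (-Real.log (exp (2 * (299 / 1000)) * (14 / 15 * ((((4 : ℕ) : ℝ) - 1) * (1 / 8))) +
          exp (299 / 1000) * Real.sqrt (4 / 5) * (299 / 1000)) / max r 1) :=
  su3_torusRowUpTo (by norm_num) hP hV (by norm_num) (by norm_num) (by norm_num) (by norm_num) r (by norm_num)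

/-- `d = 4` UpTo row `(1/4, 0.116)` on H1, H2. [folklore] -/
theorem su3_torusRowUpTo4_1_4 (hP : OneLinkPoincareSUN 3 (3 / 5) (4 / 5)) (hV : OneLinkVarianceBound 3 (11 / 30) (49 / 20)) (r : ℕ) :
    TorusClusteringOnBallUpTo 3 4 ((1 / 4 : ℝ) / 3) (2 * (29 / 250)) (29 / 250) r 24
      (-Real.log (exp (2 * (29 / 250)) * (14 / 15 * ((((4 : ℕ) : ℝ) - 1) * (1 / 4))) +
          exp (29 / 250) * Real.sqrt (4 / 5) * (29 / 250)) / max r 1) :=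
  su3_torusRowUpTo (by norm_num) hP hV (by norm_num) (by norm_num) (by norm_num) (by norm_num) r (by norm_num)

end Summit.Ventures.YMGap.RobustBallSU3

end
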